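import Summits.AtomisticToContinuum.FouriersLaw.Theorems.BondHeatUncertaintyExtensiveSnapshotIrreversibilityCorrectorHeatSplit
import HarnessLib

/-!
# Crux `ExtensiveSnapshotIrreversibility` (stmt-AtomisticToContinuum-9121), line `clausius-budget-sound-window`:
registered sub-goals `heatCommittor_sumRule` and `twoBathFisherIdentity` — two-bath bookkeeping toward stub S4v

Fixed-`N` identities for the pinned chain `P = pinnedChain ω₂ lam β γ` with both baths at `T > 0`
(equilibrium kernels `P_t = P.transitionKernel N T T t`, Gibbs state `μ_T`), under (MIX) = CEHR (2.5) in the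
`e^{ϑH}`-weighted norm. With the one-bath heat sources `f_L = γ(p_0² − T)`, `f_R = γ(p_{N−1}² − T)` and the
heat committors `Q_L = ∫₀^∞ P_s f_L ds`, `Q_R = ∫₀^∞ P_s f_R ds` (absolutely convergent, in `L²(μ_T)`:
the landed S4s `stub_correctorHeatSplit`):

* `heatCommittor_sumRule`: `Q_L + Q_R = H − μ_T(H)` pointwise (energy conservation: `L H = −(f_L + f_R)`,
  Dynkin for `H`, and `P_r H → μ_T(H)` by (MIX));
* `twoBathFisherIdentity`: `Q_L Q_R ∈ L¹(μ_T)` and `4T⁴ ∫ w² dμ_T = ∫ (H − μ_T H)² dμ_T − 4 ∫ Q_L Q_R dμ_T`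
  for the McLennan corrector `w = (Q_L − Q_R)/(2T²)` (the 2×2 Gram algebra `(a − b)² = (a + b)² − 4ab`).

References: N. Cuneo, J.-P. Eckmann, M. Hairer, L. Rey-Bellet, EJP 23 (2018) no. 55, Thm 2.13 (3) eq. (2.5),
§3 eq. (3.4); J. A. McLennan, Phys. Rev. 115 (1959).
-/

noncomputable section

namespace Summit.AtomisticToContinuum.FouriersLaw.Theorems.ExtensiveSnapshotIrreversibility.ClausiusBudget

open MeasureTheory ProbabilityTheory Filter Topology Set
open scoped ENNReal NNReal
open Literature.MathematicalPhysics.KineticTheory.HeatConduction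
open Summit.AtomisticToContinuum.FouriersLaw.Theorems.SubdiffusiveBondHeat (abs_sq_momentum_sub_le_exp)
open Summit.AtomisticToContinuum.FouriersLaw.Theorems.IncoherentBounded
  (pinnedChain_hamiltonian_dynkin pinnedChain_generator_hamiltonian)

/-- **Sum rule for the one-bath heat committors** (fixed `N ≥ 2`): `Q_L + Q_R = H − μ_T(H)` pointwise — all the
initial excess energy is eventually absorbed by the two baths (Dynkin for `H`, `L H = −(f_L + f_R)`, and (MIX)).
Proof: `L H = γ((T − p_0²) + (T − p_{N−1}²)) = −(f_L + f_R)` (`pinnedChain_generator_hamiltonian`); Dynkin for `H`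
(`pinnedChain_hamiltonian_dynkin`) gives `∫₀ʳ (P_s f_L + P_s f_R)(z) ds = H z − P_r H(z)` for `r ≥ 0`; as `r → ∞`
the left side tends to `Q_L z + Q_R z` (absolute convergence, `stub_correctorHeatSplit`) and the right side to
`H z − μ_T(H)` by (MIX) (`0 ≤ H ≤ C₀ e^{H/4T}`). [folklore] -/
theorem heatCommittor_sumRule :
    ∀ ω₂ lam β γ : ℝ, 0 < ω₂ → 0 < lam → 0 < β → 0 < γ → ∀ T : ℝ, 0 < T → ∀ (N : ℕ) (hN : 2 ≤ N),
      let P := pinnedChain ω₂ lam β γ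
      let μT := P.gibbsMeasure N T
      (∀ t : ℝ≥0, μT.bind (P.transitionKernel N T T t) = μT) →
      (∀ ϑ : ℝ, 0 < ϑ → ϑ < 1 / T → ∃ C c : ℝ, 0 < C ∧ 0 < c ∧
        ∀ (z : PhaseSpace N) (t : ℝ≥0) (f : PhaseSpace N → ℝ), Continuous f →
          (∀ y, |f y| ≤ Real.exp (ϑ * P.hamiltonian N y)) →
          |(∫ y, f y ∂(P.transitionKernel N T T t z)) - ∫ y, f y ∂μT| ≤
            C * Real.exp (ϑ * P.hamiltonian N z) * Real.exp (-c * t)) →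
      let fL : PhaseSpace N → ℝ := fun y => γ * (y.2 ⟨0, by omega⟩ ^ 2 - T)
      let fR : PhaseSpace N → ℝ := fun y => γ * (y.2 ⟨N - 1, by omega⟩ ^ 2 - T)
      let PfL : ℝ → PhaseSpace N → ℝ := fun s z => ∫ y, fL y ∂(P.transitionKernel N T T s.toNNReal z)
      let PfR : ℝ → PhaseSpace N → ℝ := fun s z => ∫ y, fR y ∂(P.transitionKernel N T T s.toNNReal z)
      let QL : PhaseSpace N → ℝ := fun z => ∫ s in Set.Ioi (0 : ℝ), PfL s z
      let QR : PhaseSpace N → ℝ := fun z => ∫ s in Set.Ioi (0 : ℝ), PfR s z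
      ∀ z : PhaseSpace N, QL z + QR z = P.hamiltonian N z - ∫ x, P.hamiltonian N x ∂μT := by
  intro ω₂ lam β γ hω hl hβ hγ T hT N hN P μT hINV hMIX fL fR PfL PfR QL QR z
  have hN0 : 0 < N := by omega
  -- absolute convergence of the two Kubo integrals (the landed S4s)
  obtain ⟨hAL, hAR, -⟩ := stub_correctorHeatSplit ω₂ lam β γ hω hl hβ hγ T hT N hN hINV hMIX
  have hALz : IntegrableOn (fun s => PfL s z) (Ioi (0 : ℝ)) := hAL z
  have hARz : IntegrableOn (fun s => PfR s z) (Ioi (0 : ℝ)) := hAR z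
  -- the weight `e^{ϑH}`, `ϑ = 1/(4T)`, and the mixing constants
  set ϑ : ℝ := 1 / (4 * T) with hϑ_def
  have hϑ : 0 < ϑ := by positivity
  have hϑT : ϑ < 1 / T := by
    rw [hϑ_def, div_lt_div_iff₀ (by positivity) hT]; nlinarith
  obtain ⟨C, c, -, hc, hmix⟩ := hMIX ϑ hϑ hϑT
  -- the energy: nonnegative, continuous, dominated by `C₀ e^{ϑH}`
  have hH0 : ∀ y, 0 ≤ P.hamiltonian N y := fun y => pinnedChain_hamiltonian_nonneg hω.le hl.le hβ.le γ N y
  have hHc : Continuous (P.hamiltonian N) := pinnedChain_continuous_hamiltonian ω₂ lam β γ N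
  set C₀ : ℝ := 2 * Real.exp ϑ / ϑ ^ 2 with hC₀_def
  have hC₀ : 0 ≤ C₀ := by positivity
  have hHM : ∀ y, |P.hamiltonian N y| ≤ C₀ * Real.exp (ϑ * P.hamiltonian N y) := fun y => by
    rw [abs_of_nonneg (hH0 y)]
    exact le_trans (by nlinarith [hH0 y]) (one_add_sq_le_exp (hH0 y) hϑ)
  -- the one-bath sources: continuity, domination, kernel integrability
  have hfc : ∀ i : Fin N, Continuous fun y : PhaseSpace N => γ * (y.2 i ^ 2 - T) := fun i => by
    fun_prop
  have hfM : ∀ (i : Fin N) (y : PhaseSpace N),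
      |γ * (y.2 i ^ 2 - T)| ≤ γ * (2 / ϑ + T) * Real.exp (ϑ * P.hamiltonian N y) := fun i y => by
    rw [abs_mul, abs_of_pos hγ, mul_assoc]
    exact mul_le_mul_of_nonneg_left (abs_sq_momentum_sub_le_exp hω hl.le hβ.le hϑ hT.le y i) hγ.le
  have hintL : ∀ s : ℝ, Integrable fL (P.transitionKernel N T T s.toNNReal z) := fun s =>
    integrable_transitionKernel_of_le_exp hω hl hβ hγ hT hN0 hϑ hϑT (hfc ⟨0, hN0⟩) (hfM ⟨0, hN0⟩) _ z
  have hintR : ∀ s : ℝ, Integrable fR (P.transitionKernel N T T s.toNNReal z) := fun s =>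
    integrable_transitionKernel_of_le_exp hω hl hβ hγ hT hN0 hϑ hϑT (hfc ⟨N - 1, by omega⟩)
      (hfM ⟨N - 1, by omega⟩) _ z
  -- `L H = -(f_L + f_R)`, sliced along `P_s(z, ·)`
  have hslice : ∀ s : ℝ,
      ∫ y, P.generator N T T (P.hamiltonian N) y ∂(P.transitionKernel N T T s.toNNReal z) =
        -(PfL s z + PfR s z) := fun s => by
    show _ = -((∫ y, fL y ∂(P.transitionKernel N T T s.toNNReal z)) +
      ∫ y, fR y ∂(P.transitionKernel N T T s.toNNReal z))
    rw [← integral_add (hintL s) (hintR s), ← integral_neg]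
    refine integral_congr_ae (Eventually.of_forall fun y => ?_)
    show P.generator N T T (P.hamiltonian N) y =
      -(γ * (y.2 ⟨0, hN0⟩ ^ 2 - T) + γ * (y.2 ⟨N - 1, by omega⟩ ^ 2 - T))
    rw [pinnedChain_generator_hamiltonian hN0]
    ring
  -- local integrability of the two slices on `[0, r]`
  have hIIL : ∀ r : ℝ, 0 ≤ r → IntervalIntegrable (fun s => PfL s z) volume 0 r := fun r hr =>
    (intervalIntegrable_iff_integrableOn_Ioc_of_le hr).2 (hALz.mono_set Ioc_subset_Ioi_self)
  have hIIR : ∀ r : ℝ, 0 ≤ r → IntervalIntegrable (fun s => PfR s z) volume 0 r := fun r hr =>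
    (intervalIntegrable_iff_integrableOn_Ioc_of_le hr).2 (hARz.mono_set Ioc_subset_Ioi_self)
  -- Dynkin for `H`: `∫₀ʳ P_s f_L (z) + ∫₀ʳ P_s f_R (z) = H z - P_r H (z)` for `r ≥ 0`
  have hId : ∀ r : ℝ, 0 ≤ r →
      (∫ s in (0 : ℝ)..r, PfL s z) + ∫ s in (0 : ℝ)..r, PfR s z =
        P.hamiltonian N z - ∫ y, P.hamiltonian N y ∂(P.transitionKernel N T T r.toNNReal z) := by
    intro r hr
    have h1 : (∫ y, P.hamiltonian N y ∂(P.transitionKernel N T T r.toNNReal z)) - P.hamiltonian N z =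
        ∫ s in (0 : ℝ)..(r.toNNReal : ℝ),
          ∫ y, P.generator N T T (P.hamiltonian N) y ∂(P.transitionKernel N T T s.toNNReal z) :=
      pinnedChain_hamiltonian_dynkin hω hl.le hβ hγ hN0 hT r.toNNReal z
    have h2 : ∫ s in (0 : ℝ)..r,
        ∫ y, P.generator N T T (P.hamiltonian N) y ∂(P.transitionKernel N T T s.toNNReal z) =
        ∫ s in (0 : ℝ)..r, -(PfL s z + PfR s z) :=
      intervalIntegral.integral_congr fun s _ => hslice s
    have h3 : ∫ s in (0 : ℝ)..r, -(PfL s z + PfR s z) =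
        -((∫ s in (0 : ℝ)..r, PfL s z) + ∫ s in (0 : ℝ)..r, PfR s z) := by
      rw [intervalIntegral.integral_neg, intervalIntegral.integral_add (hIIL r hr) (hIIR r hr)]
    rw [Real.coe_toNNReal r hr, h2, h3] at h1
    linarith
  -- pass to the limit `r → ∞`
  have hlimL : Tendsto (fun r : ℝ => ∫ s in (0 : ℝ)..r, PfL s z) atTop (𝓝 (QL z)) :=
    intervalIntegral_tendsto_integral_Ioi 0 hALz tendsto_id
  have hlimR : Tendsto (fun r : ℝ => ∫ s in (0 : ℝ)..r, PfR s z) atTop (𝓝 (QR z)) :=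
    intervalIntegral_tendsto_integral_Ioi 0 hARz tendsto_id
  have hlimH : Tendsto (fun r : ℝ => ∫ y, P.hamiltonian N y ∂(P.transitionKernel N T T r.toNNReal z)) atTop
      (𝓝 (∫ y, P.hamiltonian N y ∂μT)) :=
    tendsto_act_of_mix hmix hc hHc hC₀ hHM z
  have hF : Tendsto (fun r : ℝ => P.hamiltonian N z -
      ∫ y, P.hamiltonian N y ∂(P.transitionKernel N T T r.toNNReal z)) atTop
      (𝓝 (P.hamiltonian N z - ∫ y, P.hamiltonian N y ∂μT)) :=
    hlimH.const_sub _
  have hG : Tendsto (fun r : ℝ => P.hamiltonian N z -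
      ∫ y, P.hamiltonian N y ∂(P.transitionKernel N T T r.toNNReal z)) atTop (𝓝 (QL z + QR z)) :=
    (hlimL.add hlimR).congr' (by filter_upwards [eventually_ge_atTop (0 : ℝ)] with r hr using hId r hr)
  exact tendsto_nhds_unique hG hF

/-- **Two-bath Fisher identity** (fixed `N ≥ 2`): `4T⁴ ∫ w² dμ_T = Var_{μ_T}(H) − 4 ∫ Q_L Q_R dμ_T` — the full Fisher
information of the two-temperature family at equilibrium is extensive iff the two heat committors are not anticorrelated
beyond `O(N)` (card two-bath-fisher-covariance). Proof: `Q_L, Q_R ∈ L²(μ_T)` and `w = (Q_L − Q_R)/(2T²)` pointwise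
(`stub_correctorHeatSplit`), so `Q_L Q_R ∈ L¹` (Hölder); `4T⁴ w² = (Q_L + Q_R)² − 4 Q_L Q_R = (H − μ_T H)² − 4 Q_L Q_R`
pointwise by `heatCommittor_sumRule`; integrate. [folklore] -/
theorem twoBathFisherIdentity :
    ∀ ω₂ lam β γ : ℝ, 0 < ω₂ → 0 < lam → 0 < β → 0 < γ → ∀ T : ℝ, 0 < T → ∀ (N : ℕ) (hN : 2 ≤ N),
      let P := pinnedChain ω₂ lam β γ
      let μT := P.gibbsMeasure N T
      (∀ t : ℝ≥0, μT.bind (P.transitionKernel N T T t) = μT) →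
      (∀ ϑ : ℝ, 0 < ϑ → ϑ < 1 / T → ∃ C c : ℝ, 0 < C ∧ 0 < c ∧
        ∀ (z : PhaseSpace N) (t : ℝ≥0) (f : PhaseSpace N → ℝ), Continuous f →
          (∀ y, |f y| ≤ Real.exp (ϑ * P.hamiltonian N y)) →
          |(∫ y, f y ∂(P.transitionKernel N T T t z)) - ∫ y, f y ∂μT| ≤
            C * Real.exp (ϑ * P.hamiltonian N z) * Real.exp (-c * t)) →
      let g : PhaseSpace N → ℝ := fun y =>
        γ / (2 * T ^ 2) * (y.2 ⟨0, by omega⟩ ^ 2 - y.2 ⟨N - 1, by omega⟩ ^ 2)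
      let Pg : ℝ → PhaseSpace N → ℝ := fun s z => ∫ y, g y ∂(P.transitionKernel N T T s.toNNReal z)
      let w : PhaseSpace N → ℝ := fun z => ∫ s in Set.Ioi (0 : ℝ), Pg s z
      let fL : PhaseSpace N → ℝ := fun y => γ * (y.2 ⟨0, by omega⟩ ^ 2 - T)
      let fR : PhaseSpace N → ℝ := fun y => γ * (y.2 ⟨N - 1, by omega⟩ ^ 2 - T)
      let PfL : ℝ → PhaseSpace N → ℝ := fun s z => ∫ y, fL y ∂(P.transitionKernel N T T s.toNNReal z)
      let PfR : ℝ → PhaseSpace N → ℝ := fun s z => ∫ y, fR y ∂(P.transitionKernel N T T s.toNNReal z)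
      let QL : PhaseSpace N → ℝ := fun z => ∫ s in Set.Ioi (0 : ℝ), PfL s z
      let QR : PhaseSpace N → ℝ := fun z => ∫ s in Set.Ioi (0 : ℝ), PfR s z
      Integrable (fun z => QL z * QR z) μT ∧
      4 * T ^ 4 * ∫ z, (w z) ^ 2 ∂μT =
        (∫ z, (P.hamiltonian N z - ∫ x, P.hamiltonian N x ∂μT) ^ 2 ∂μT) - 4 * ∫ z, QL z * QR z ∂μT := by
  intro ω₂ lam β γ hω hl hβ hγ T hT N hN P μT hINV hMIX g Pg w fL fR PfL PfR QL QR
  -- `Q_L, Q_R ∈ L²(μ_T)` and the pointwise split `w = (Q_L - Q_R)/(2T²)` (the landed S4s)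
  obtain ⟨-, -, hQL, hQR, h5, -⟩ := stub_correctorHeatSplit ω₂ lam β γ hω hl hβ hγ T hT N hN hINV hMIX
  have hQL' : MemLp QL 2 μT := hQL
  have hQR' : MemLp QR 2 μT := hQR
  have h5' : ∀ z : PhaseSpace N, w z = (QL z - QR z) / (2 * T ^ 2) := h5
  -- the sum rule `Q_L + Q_R = H - μ_T(H)`
  set mH : ℝ := ∫ x, P.hamiltonian N x ∂μT with hmH_def
  have hsum : ∀ z : PhaseSpace N, QL z + QR z = P.hamiltonian N z - mH :=
    heatCommittor_sumRule ω₂ lam β γ hω hl hβ hγ T hT N hN hINV hMIX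
  -- Hölder: `Q_L Q_R ∈ L¹(μ_T)`
  have hprod : Integrable (fun z => QL z * QR z) μT := hQL'.integrable_mul hQR'
  -- the Gram algebra `4T⁴ w² = (Q_L + Q_R)² - 4 Q_L Q_R = (H - μ_T H)² - 4 Q_L Q_R`, pointwise
  have hT2 : (2 * T ^ 2 : ℝ) ≠ 0 := by positivity
  have hpt : ∀ z : PhaseSpace N,
      4 * T ^ 4 * (w z) ^ 2 = (P.hamiltonian N z - mH) ^ 2 - 4 * (QL z * QR z) := fun z => by
    rw [h5' z, ← hsum z]
    field_simp
    ring
  have hsq : Integrable (fun z => (P.hamiltonian N z - mH) ^ 2) μT := by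
    refine (hQL'.add hQR').integrable_sq.congr (Eventually.of_forall fun z => ?_)
    show (QL z + QR z) ^ 2 = (P.hamiltonian N z - mH) ^ 2
    rw [hsum z]
  refine ⟨hprod, ?_⟩
  calc 4 * T ^ 4 * ∫ z, (w z) ^ 2 ∂μT = ∫ z, 4 * T ^ 4 * (w z) ^ 2 ∂μT := (integral_const_mul _ _).symm
    _ = ∫ z, ((P.hamiltonian N z - mH) ^ 2 - 4 * (QL z * QR z)) ∂μT :=
        integral_congr_ae (Eventually.of_forall hpt)
    _ = (∫ z, (P.hamiltonian N z - mH) ^ 2 ∂μT) - 4 * ∫ z, QL z * QR z ∂μT := by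
        rw [integral_sub hsq (hprod.const_mul 4), integral_const_mul]

end Summit.AtomisticToContinuum.FouriersLaw.Theorems.ExtensiveSnapshotIrreversibility.ClausiusBudget

end
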